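import Literature.MathematicalPhysics.QuantumLattice.HubbardModelParticleHoleProofs
import Literature.MathematicalPhysics.QuantumLattice.HubbardHubbardModelEtaPairingProofs
import HarnessLib

/-!
# Dimension bookkeeping for the fermionic torus: `|Orb| = 2L^d`, `dim Fock = 4^{L^d}`, `log dim Fock = L^d · log 4`

Topic `Literature/MathematicalPhysics/QuantumLattice` (folklore bookkeeping, family `hubbard`). The Fock space of the
spin-½ lattice fermions on the discrete torus `(ℤ/Lℤ)^d` (`FermionTorus d L`, `HubbardModel.lean`) is indexed by the subsets
of the `2L^d` spin-orbitals `Orb (FermionTorus d L)`, so its dimension is `2^{2L^d} = 4^{L^d}` and the ENTROPY BUDGET per site in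
every energy–entropy (Gibbs variational) estimate on the torus is `log 4`:
`Re ⟨H⟩_β ≤ E₀(H) + L^d · log 4 / β` (`Matrix.re_gibbsState_hamiltonian_le` with `log dim`). This file HOISTS the three
one-line facts that several Summits-side files re-prove locally (`HubbardLadder.Bounds.log_card_fock_fermionTorus_two`,
`…Observables.card_fock_index` / `log_card_fock_index` in `CrutchODLROFloorThermal.lean`, private copies of
`card_orb_fermionTorus_two` in `HubbardTTPrimeGrandCanonicalTorusLimit.lean` / `HubbardNNNHoppingGrandCanonicalFloor.lean` /
`SectorTwistRatioElementary.lean`, `log_card_fock` in two crux disproofs), in general dimension `d`, from the tree's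
`card_orb` (`HubbardModelParticleHoleProofs.lean`) and `card_fermionTorus` (`HubbardHubbardModelEtaPairingProofs.lean`); the `d = 2` statements already in the tree (`card_orb_fermionTorus_two` in `DWaveSourceFreePressure.lean`, the copies listed above) are the
`d = 2` instances of these and are NOT restated here (the gate's dedup rule); new users instantiate `card_fock_fermionTorus 2 L`.

No definition, no named fact, no `sorry`. [folklore]

References: O. Bratteli, D. W. Robinson, *Operator Algebras and Quantum Statistical Mechanics II* (1997), §5.2.1 (CAR algebra
of a finite set of modes ≅ `M_{2^n}`); H. Tasaki, *Physics and Mathematics of Quantum Many-Body Systems* (2020), §9.2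
(Hubbard model Hilbert space).
-/

namespace Literature.MathematicalPhysics.QuantumLattice

open Literature.Probability.LatticeModels

/-- The torus carries `2 · L^d` spin-orbitals. [cite: Tasaki2020, §9.2] -/
theorem card_orb_fermionTorus (d L : ℕ) : Fintype.card (Orb (FermionTorus d L)) = 2 * L ^ d := by
  rw [card_orb, card_fermionTorus]

/-- **`dim Fock = 4^{L^d}`**: the Fock space of the torus (indexed by `Finset (Orb (FermionTorus d L))`, i.e. by occupation
patterns of the `2L^d` spin-orbitals) has dimension `2^{2L^d} = 4^{L^d}`. [cite: BratteliRobinsonII1997, §5.2.1] -/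
theorem card_fock_fermionTorus (d L : ℕ) : Fintype.card (Finset (Orb (FermionTorus d L))) = 4 ^ (L ^ d) := by
  rw [Fintype.card_finset, card_orb_fermionTorus, pow_mul]
  norm_num

/-- **`log dim Fock = L^d · log 4`** — the entropy budget per site is `log 4`. [cite: BratteliRobinsonII1997, §5.2.1] -/
theorem log_card_fock_fermionTorus (d L : ℕ) :
    Real.log (Fintype.card (Finset (Orb (FermionTorus d L)))) = ((L : ℝ) ^ d) * Real.log 4 := by
  rw [card_fock_fermionTorus]
  push_cast
  rw [Real.log_pow]
  push_cast
  ring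

end Literature.MathematicalPhysics.QuantumLattice
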